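/-
Origin: expansion seat `planner-pub-hodgecm-mc-axioms-1-g14-0`, handover #W218 2026-08-20T15:53:55Z md5 c941110b769e (PKG 7461eec8633b → c941110b769e; 107 l.; MECHANICAL (iib-R) rewrite v3.1 of the PKG file as it stands (30 token edits; rules R1x1+RX[h₂']x29)) (`HOME/mc/pub-hodgecm-mc-axioms-1-g14/revendor/kit-r55/stage55/HodgeCM/Model/Binders/Real34WedgeOfArchKType.lean`, md5 c941110b769e, 107 lines);
landed by the gen-22 packager (p-g22) in gate run 55 REPLACES the earlier landed copy of `HodgeCM/Model/Binders/Real34WedgeOfArchKType.lean` (seat copy carried the packager Origin header of an earlier run (stripped)).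
-/
/-
# The admissible (34) wedge of a PAIR of archimedean `K`-type data of lines `2` and `3`

Binder-1 (rows 14/15 `gen12`/`real34`, node B2-meet) — generation 11.

RUN-44 #40 `Binders/Real34WedgeSpan` defines `admWedgeSet S₀ hV` / `admWedgeSpan S₀ hV` — the admissible (34) wedges
`tau34 (φ₂ 0) (φ₃ 1) − tau34 (φ₂ 1) (φ₃ 0)` of `adm₃₄`-admissible situations of lines `2`, `3` at a COMMON level with the
frame equations — and `Binders/ArchKTypeHolType` proves `adm₃₄` of the product situation of ONE archimedean `K`-type datum
at every `k` from (H1)/(AN)/(REP).  This leaf puts the two together: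

* `wedge_mem_admWedgeSpan_of_frames` — the wedge of two frames with packaged admissible situations (line `2` and line
  `3`, same level `Γ`) lies in `admWedgeSpan` (the existential currency of
  `ArchKTypeData.exists_adm₃₄_frame_of_isPMinusKilledAlong`);
* `ArchKTypeData.wedge_mem_admWedgeSpan_of_isPMinusKilledAlong` — for `B₂ : ArchKTypeData 𝕏 2 N₂`,
  `B₃ : ArchKTypeData 𝕏 3 N₃` at a common level (`B₃.Γ₀ = B₂.Γ₀`) with their (H1)/(AN)/(REP) hypotheses (the exact
  shapes of E's rows `hT`/`hpd`/`hk` at `k = 2, 3`), the wedge of the one-family frames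
  `tau34 (Φfam₂ e₀^∨) (Φfam₃ e₁^∨) − tau34 (Φfam₂ e₁^∨) (Φfam₃ e₀^∨)` lies in `admWedgeSpan 𝕏`.

This is the archimedean-`K`-type half of row 15's (W) `hmatched` (`Real34CensusSideT.ofEigenletters`): what remains
there is the LETTER identification of binder-2's matched eigen pure tensors with sums of such wedges.

Nothing is cited and nothing is minted: kernel lemmas over the installed definitions.
-/
import Summits.HodgeConjecture.HodgeCM.Model.Binders.Real34WedgeSpan
import Summits.HodgeConjecture.HodgeCM.Model.Binders.ArchKTypeHolType

/-! PORT of `HodgeCM/Model/Binders/Real34WedgeOfArchKType.lean` (HodgeCMPerL run 82) — verbatim mechanical port; provenance in the PORT header line. -/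

set_option autoImplicit false

noncomputable section

open scoped Classical SchwartzMap
open MulAction NumberField NumberField.mixedEmbedding
open Literature.Geometry.ComplexHyperbolic.BallModel (U21 Ball x₀)
open Literature.NumberTheory.Automorphic Literature.NumberTheory.Weil1964
open Literature.AlgebraicGeometry.HodgeTheory
open Literature.AlgebraicGeometry.ShimuraVarieties
open Literature.NumberTheory.Automorphic.PicardCM
open HodgeCM.PerL34.Seesaw HodgeCM.PerL34.RationalCoset HodgeCM.PerL34.SupplyAdelic
open HodgeCM.Model.SupplyInstance HodgeCM.Model.SupplyResidual
open HodgeCM.Model.ThetaSpace HodgeCM.Model.ArchSideTerm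

namespace HodgeCM
namespace Model

section WedgeOfArchKType

variable (hHD : exists_isReal_hodgeModel) (hI : hodgePQ_independent_of_hodgeModel)
  (h₁ : BallQuotientUniformised)  (h₃ : CMAbelianVarietyRealised)

variable {L : CMField} {ι₁ : L →+* ℂ} {V : HermSpace3 L ι₁} {c : SeesawCtx L}

/-- **The wedge of two packaged admissible frames lies in `admWedgeSpan`** (lines `2` and `3`, common level `Γ`). -/
theorem wedge_mem_admWedgeSpan_of_frames (S₀ : ThetaAdelicSide V c) (hV : IsAnisotropic L V.Hm) (Γ : Level V)
    (φ₂ φ₃ : Fin 2 → piSchwartzBruhat (thetaSpaceInputIn hHD hI h₁ h₃ S₀ hV).K (Fin 3))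
    (hφ₂ : ∃ (Sit : KTypeSituation ((thetaSpaceInputIn hHD hI h₁ h₃ S₀ hV).P 2)
        ((thetaSpaceInputIn hHD hI h₁ h₃ S₀ hV).ιinf Γ) ((thetaSpaceInputIn hHD hI h₁ h₃ S₀ hV).Δ Γ)
        (thetaSpaceInputIn hHD hI h₁ h₃ S₀ hV).κ₁ (thetaSpaceInputIn hHD hI h₁ h₃ S₀ hV).τ₁)
      (j : {j : Sit.E →ₗ[ℂ] ((thetaSpaceInputIn hHD hI h₁ h₃ S₀ hV).P 2).weilDatum.ThetaTop //
        ((thetaSpaceInputIn hHD hI h₁ h₃ S₀ hV).P 2).kernelDatum.IsThetaEquivariant Sit.κ Sit.σ j}),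
      (adm₃₄ hHD hI h₁ h₃ S₀ hV Γ 2 Sit ∧ j ∈ Sit.𝓙) ∧
        ∀ a : Fin 2, ((thetaSpaceInputIn hHD hI h₁ h₃ S₀ hV).P 2).weilDatum.toThetaTop (φ₂ a) =
          j.1 (Sit.ι (LinearMap.proj a)))
    (hφ₃ : ∃ (Sit : KTypeSituation ((thetaSpaceInputIn hHD hI h₁ h₃ S₀ hV).P 3)
        ((thetaSpaceInputIn hHD hI h₁ h₃ S₀ hV).ιinf Γ) ((thetaSpaceInputIn hHD hI h₁ h₃ S₀ hV).Δ Γ)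
        (thetaSpaceInputIn hHD hI h₁ h₃ S₀ hV).κ₁ (thetaSpaceInputIn hHD hI h₁ h₃ S₀ hV).τ₁)
      (j : {j : Sit.E →ₗ[ℂ] ((thetaSpaceInputIn hHD hI h₁ h₃ S₀ hV).P 3).weilDatum.ThetaTop //
        ((thetaSpaceInputIn hHD hI h₁ h₃ S₀ hV).P 3).kernelDatum.IsThetaEquivariant Sit.κ Sit.σ j}),
      (adm₃₄ hHD hI h₁ h₃ S₀ hV Γ 3 Sit ∧ j ∈ Sit.𝓙) ∧
        ∀ a : Fin 2, ((thetaSpaceInputIn hHD hI h₁ h₃ S₀ hV).P 3).weilDatum.toThetaTop (φ₃ a) =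
          j.1 (Sit.ι (LinearMap.proj a))) :
    tau34 V c.D (φ₂ 0) (φ₃ 1) - tau34 V c.D (φ₂ 1) (φ₃ 0) ∈ admWedgeSpan hHD hI h₁ h₃ S₀ hV := by
  obtain ⟨Sit₂, j₂, ⟨hadm₂, hj₂⟩, hfr₂⟩ := hφ₂
  obtain ⟨Sit₃, j₃, ⟨hadm₃, hj₃⟩, hfr₃⟩ := hφ₃
  exact wedge_mem_admWedgeSpan hHD hI h₁ h₃ S₀ hV Γ Sit₂ j₂ Sit₃ j₃ φ₂ φ₃ ⟨hadm₂, hj₂, hadm₃, hj₃⟩ hfr₂ hfr₃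

/-- **The admissible (34) wedge of a pair of archimedean `K`-type data of lines `2`, `3` at a common level**
((H1) + (AN) + (REP) along `-i e_p`, for both): the wedge of the one-family frames
`tau34 (Φfam₂ e₀^∨) (Φfam₃ e₁^∨) − tau34 (Φfam₂ e₁^∨) (Φfam₃ e₀^∨)` lies in `admWedgeSpan 𝕏`. -/
theorem ArchKTypeData.wedge_mem_admWedgeSpan_of_isPMinusKilledAlong (S₀ : ThetaAdelicSide V c)
    (hV : IsAnisotropic L V.Hm) {N₂ N₃ : ℕ}
    (B₂ : ArchKTypeData (thetaSpaceInputIn hHD hI h₁ h₃ S₀ hV) 2 N₂)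
    (B₃ : ArchKTypeData (thetaSpaceInputIn hHD hI h₁ h₃ S₀ hV) 3 N₃) (hΓ : B₃.Γ₀ = B₂.Γ₀)
    (hT₂ : ((thetaSpaceInputIn hHD hI h₁ h₃ S₀ hV).P 2).IsThetaArchContinuous N₂)
    (hd₂ : B₂.IsWeaklyPDiff BallForms.expP)
    (hk₂ : ∀ p : Fin 2, B₂.IsPMinusKilledAlong BallForms.expP (-Complex.I • (Pi.single p 1 : Fin 2 → ℂ)))
    (hT₃ : ((thetaSpaceInputIn hHD hI h₁ h₃ S₀ hV).P 3).IsThetaArchContinuous N₃)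
    (hd₃ : B₃.IsWeaklyPDiff BallForms.expP)
    (hk₃ : ∀ p : Fin 2, B₃.IsPMinusKilledAlong BallForms.expP (-Complex.I • (Pi.single p 1 : Fin 2 → ℂ))) :
    tau34 V c.D (B₂.toProduct.Φfam (LinearMap.proj 0)) (B₃.toProduct.Φfam (LinearMap.proj 1)) -
        tau34 V c.D (B₂.toProduct.Φfam (LinearMap.proj 1)) (B₃.toProduct.Φfam (LinearMap.proj 0)) ∈
      admWedgeSpan hHD hI h₁ h₃ S₀ hV := by
  have hφ₂ := B₂.exists_adm₃₄_frame_of_isPMinusKilledAlong hHD hI h₁ h₃ S₀ hV hT₂ hd₂ hk₂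
  have hφ₃ := B₃.exists_adm₃₄_frame_of_isPMinusKilledAlong hHD hI h₁ h₃ S₀ hV hT₃ hd₃ hk₃
  rw [hΓ] at hφ₃
  exact wedge_mem_admWedgeSpan_of_frames hHD hI h₁ h₃ S₀ hV B₂.Γ₀
    (fun a => B₂.toProduct.Φfam (LinearMap.proj a)) (fun a => B₃.toProduct.Φfam (LinearMap.proj a)) hφ₂ hφ₃

end WedgeOfArchKType

end Model
end HodgeCM

end
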